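import Literature.AlgebraicGeometry.AbelianSchemes.PELTupleStageLocalise                 -- ★ GS-2-core (stage maps `whiskerLeft_left_comp_whiskerLeft_left_eq_leg`; re-exports `TupleRelCancel`)
import Literature.AlgebraicGeometry.AbelianSchemes.AbelianSchemeOverSpreadStageStructure    -- ★ `isMonHom_facObjIso_hom∕_inv` (induced structures), stage vocabulary
import Literature.AlgebraicGeometry.AbelianSchemes.DescendedHomBaseChangeComp               -- ★ `DualPair.nonempty_pullback_map_iso_of_comp_eq`, `…_P_iso_baseChange_baseChange_P`
import Literature.AlgebraicGeometry.AbelianSchemes.PolarizedAbelianSchemeWithLevelBaseChange -- ★ `DualPair.nonempty_pullback_map_P_iso_baseChange_P`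
import Literature.AlgebraicGeometry.AbelianSchemes.AbelianSchemeOverFibreIdentity           -- ★ `isBaseChangeVia_id_of_isMonHom`, `levelStructure_isBaseChangeVia_id_of_isMonHom`
import Literature.AlgebraicGeometry.Limits.LocalizationRelativeGroupSpreadDock              -- ★ `OverFac.facObjIso_inv_left_fst_fst` (projections of `facObjIso⁻¹`)
import HarnessLib

/-!
# The canonical identification `(𝒜 ×_X T) ×_T G ≅ 𝒜 ×_X G` of a FACTORISATION `ℓ : G → T` over `X` (★ `OverFac.facObjIso`) IS an
# isomorphism of PEL tuples along `𝟙 G` — the currency of the spread organs (s1)∕(s1-ι)∕(s2-λ)∕(s3)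

Topic `AlgebraicGeometry/AbelianSchemes`; namespace `Literature.AlgebraicGeometry.AbelianSchemes.AbelianSchemeOver`.  THEOREMS ONLY (no definition,
no named fact, no instance, no notation, no `sorry`).  Cell hodgecm-mathlib (D-0151), P6 «MOD programme» (crux hLiu418 = stmt-HodgeConjecture-24832,
`--supports`, count-neutral); sequel of ★ GS-2-core (`TupleRelCancel`, `PELTupleStageLocalise`, B-p18 (g39)) and of ★ BRICK (T) §4
(`tupleRel_baseChangeCompGrpIso_hom∕_inv`: the case of a LITERAL composite `x ≫ π`).  The spread organs of the SPREAD door — ★ (s1-ι)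
`exists_stage_ringAction`, ★ `exists_stage_monHom`, ★ (s3) `LevelStructure.exists_stage_of_generic_overStage`, ★ (s2-λ″) — state their generic
compatibilities through THE NAMED isomorphism `OverFac.facObjIso ℓ 𝒜.X : (𝒜_T)_ℓ ≅ 𝒜_G` of an arbitrary factorisation `ℓ : G ⟶ T` in `Over X`
(`ℓ ≫ T.hom = G.hom`); this file proves that `(facObjIso ℓ 𝒜.X, facObjIso ℓ Â.X)` satisfies the five clauses of [MumfordFogartyKirwan1994] Def. 7.2's
«isomorphism of triples» along `𝟙 G` between the pulled-back tuples `((tuple ×_X T) ×_T G)` and `(tuple ×_X G)`, plus NATURALITY in any morphism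
`φ : 𝒜 → ℬ` over `X` (the `λ`- and `𝒪`-clauses), in BOTH directions — so that an organ output `(zₛ)_ℓ ≫ facObjIso.hom = facObjIso.hom ≫ z` IS the
corresponding clause of a six-clause relation, with no comparison-of-comparisons step.  HC_CM is proved only modulo the printed citations until
rung 0 closes; nothing here is about HC.

THE MATHEMATICS ([GortzWedhorn2020] Prop. 4.16, (4.7): fibre products are unique up to unique isomorphism and transitive; [MumfordFogartyKirwan1994]
Def. 7.2: pull-back of triples «in the obvious way»).  For `ℓ : G → T` over `X` and `𝒜 → X`, `(𝒜 ×_X T) ×_T G ≅ 𝒜 ×_X G` is the map with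
projections `((a, t), g) ↦ a` and `↦ g` (★ `pullbackFacObjIso_hom_left_fst∕_snd`); it is a homomorphism for the INDUCED group laws (★
`isMonHom_facObjIso_hom`), hence a base change of group schemes along `𝟙 G` (★ `isBaseChangeVia_id_of_isMonHom`); it carries the pulled-back
sections `(σ ×_X T) ×_T G` to `σ ×_X G` (§1: same projections to `𝒜` and to `G`); the Poincaré sheaves correspond because both are pull-backs of
`𝒫` along maps to `𝒜 ×_X Â` that agree after the comparison (★ `DualPair.nonempty_pullback_map_iso_of_comp_eq`); `λ` and every `ι(a)` commute
with it by naturality (★ `pullbackFacObjIso_naturality`).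

MAIN STATEMENTS.  §1 `baseChange_baseChange_hom_comp_of_fac`, `pullback_map_fst_fst_congr_base` (projections of `facObjIso⁻¹`: ★ `OverFac.facObjIso_inv_left_fst_fst`),
`sectionBaseChange_sectionBaseChange_comp_facObjIso_hom` (+ `_inv` form);
§2 **`tupleRel_facObjIso_hom`**, **`tupleRel_facObjIso_inv`** (the five clauses along `𝟙 G.left` + `𝒪`-equivariance, for `(facObjIso ℓ 𝒜.X).hom∕.inv`
and `(facObjIso ℓ D.hat.X).hom∕.inv`); §3 the two instances of the SPREAD door: (a) `ℓ := relLeg σ` (finer stage `P ⊗ D(s)` versus the generic base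
`P ⊗ Spec K`, the junction with ★ (s1-ι)∕(s2-λ)∕(s3)): `tupleRel_facObjIso_relLeg_hom∕_inv`; (b) the `T`-leg `P ⊗ Spec K → P ⊗ Spec T → P ⊗ D(t)`
of ★ GS-2-core (`t ∈ Tˣ`): `tupleRel_facObjIso_specOver_hom` (the NAMED-MAP edition of ★ `exists_tupleRel_stage_baseChange_specOver`; inverse = §2 verbatim),
`exists_hom_genOver_overOf_left_eq` (the canonical `T`-leg `P ◁ κ`).

## References
* [MumfordFogartyKirwan1994] D. Mumford, J. Fogarty, F. Kirwan, *Geometric Invariant Theory*, 3rd ed. (1994), Ch. 7 §2 Def. 7.2 (p. 129), Def. 7.3 (p. 130).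
* [GortzWedhorn2020] U. Görtz, T. Wedhorn, *Algebraic Geometry I*, 2nd ed. (2020), Prop. 4.16 (p. 101), Section (4.7) (pp. 107–108), §(10.13).
* [EGAIV3] A. Grothendieck, J. Dieudonné, *EGA* IV₃, Publ. Math. IHÉS 28 (1966), Thm. 8.8.2 (i) and 8.8.2.5.
-/

set_option autoImplicit false

noncomputable section

-- Mathlib's `Over`/pull-back API is stated across semireducible wrappers (as in the ★ `AbelianSchemes/*` files).
set_option backward.isDefEq.respectTransparency false

universe u

open CategoryTheory CategoryTheory.Limits AlgebraicGeometry MonoidalCategory CartesianMonoidalCategory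
open Literature.AlgebraicGeometry.Limits.OverFac (facObjIso facObjIso_inv_left_fst_fst)
open Literature.AlgebraicGeometry.Limits (pullbackFacObjIso_hom_left_fst pullbackFacObjIso_hom_left_snd pullbackFacObjIso_naturality)

namespace Literature.AlgebraicGeometry.AbelianSchemes

namespace AbelianSchemeOver

/-! ### §1 The comparison map to `𝒜 ×_X Â` along `G.hom`; the pulled-back sections correspond under `facObjIso` -/

section Sections

variable {X : Scheme.{u}} {T G : Over X} (ℓ : G ⟶ T) (𝒜 : AbelianSchemeOver X)

/-- `π_{(𝒜_T)_ℓ} ≫ G.hom = (pr ≫ pr) ≫ π_𝒜` — the two cartesian squares pasted, read along `G.hom` through `ℓ ≫ T.hom = G.hom`.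
[cite: GortzWedhorn2020, Section (4.7) (pp. 107–108)] -/
theorem baseChange_baseChange_hom_comp_of_fac :
    ((𝒜.baseChange T.hom).baseChange ℓ.left).X.hom ≫ G.hom =
      (pullback.fst (pullback.snd 𝒜.X.hom T.hom) ℓ.left ≫ pullback.fst 𝒜.X.hom T.hom) ≫ 𝒜.X.hom := by
  rw [← Over.w ℓ]
  change pullback.snd (pullback.snd 𝒜.X.hom T.hom) ℓ.left ≫ ℓ.left ≫ T.hom = _
  rw [← pullback.condition_assoc, Category.assoc, ← pullback.condition]

/-- The comparison map `(𝒜_T)_ℓ ×_G (Â_T)_ℓ → 𝒜 ×_X Â` (`pr ≫ pr` on both factors) does not depend on the name of the base map: read along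
`G.hom` or along `ℓ ≫ T.hom` it is the same `pullback.map` (both are `lift (pr₁ ≫ pr ≫ pr) (pr₂ ≫ pr ≫ pr)`). [cite: GortzWedhorn2020, Prop. 4.16 (p. 101)] -/
theorem pullback_map_fst_fst_congr_base (D : 𝒜.DualPair)
    {w₁ : ((𝒜.baseChange T.hom).baseChange ℓ.left).X.hom ≫ G.hom =
      (pullback.fst (pullback.snd 𝒜.X.hom T.hom) ℓ.left ≫ pullback.fst 𝒜.X.hom T.hom) ≫ 𝒜.X.hom}
    {w₂ : ((D.baseChange T.hom).baseChange ℓ.left).hat.X.hom ≫ G.hom =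
      (pullback.fst (pullback.snd D.hat.X.hom T.hom) ℓ.left ≫ pullback.fst D.hat.X.hom T.hom) ≫ D.hat.X.hom}
    {w₁' : ((𝒜.baseChange T.hom).baseChange ℓ.left).X.hom ≫ ℓ.left ≫ T.hom =
      (pullback.fst (pullback.snd 𝒜.X.hom T.hom) ℓ.left ≫ pullback.fst 𝒜.X.hom T.hom) ≫ 𝒜.X.hom}
    {w₂' : ((D.baseChange T.hom).baseChange ℓ.left).hat.X.hom ≫ ℓ.left ≫ T.hom =
      (pullback.fst (pullback.snd D.hat.X.hom T.hom) ℓ.left ≫ pullback.fst D.hat.X.hom T.hom) ≫ D.hat.X.hom} :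
    pullback.map ((𝒜.baseChange T.hom).baseChange ℓ.left).X.hom ((D.baseChange T.hom).baseChange ℓ.left).hat.X.hom 𝒜.X.hom D.hat.X.hom
        (pullback.fst (pullback.snd 𝒜.X.hom T.hom) ℓ.left ≫ pullback.fst 𝒜.X.hom T.hom)
        (pullback.fst (pullback.snd D.hat.X.hom T.hom) ℓ.left ≫ pullback.fst D.hat.X.hom T.hom) G.hom w₁ w₂ =
      pullback.map ((𝒜.baseChange T.hom).baseChange ℓ.left).X.hom ((D.baseChange T.hom).baseChange ℓ.left).hat.X.hom 𝒜.X.hom D.hat.X.hom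
        (pullback.fst (pullback.snd 𝒜.X.hom T.hom) ℓ.left ≫ pullback.fst 𝒜.X.hom T.hom)
        (pullback.fst (pullback.snd D.hat.X.hom T.hom) ℓ.left ≫ pullback.fst D.hat.X.hom T.hom) (ℓ.left ≫ T.hom) w₁' w₂' := by
  apply pullback.hom_ext
  · simp only [pullback.lift_fst]
  · simp only [pullback.lift_snd]

/-- **The pulled-back sections correspond under `facObjIso`**: `(τ ×_X T) ×_T G`, read on `𝒜 ×_X G`, is `τ ×_X G` (both are sections of
`𝒜 ×_X G → G` with projection `G.hom ≫ τ` to `𝒜`: ★ `sectionBaseChange_left_comp_fst`, `ℓ ≫ T.hom = G.hom`).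
[cite: MumfordFogartyKirwan1994, Ch. 7 §2 Definition 7.2 (p. 129)] [cite: GortzWedhorn2020, Prop. 4.16 (p. 101)] -/
theorem sectionBaseChange_sectionBaseChange_comp_facObjIso_hom (τ : 𝒜.Sections) :
    (𝒜.baseChange T.hom).sectionBaseChange ℓ.left (𝒜.sectionBaseChange T.hom τ) ≫ (facObjIso ℓ 𝒜.X).hom =
      𝒜.sectionBaseChange G.hom τ := by
  apply Over.OverMorphism.ext
  rw [Over.comp_left]
  have h1 : ((𝒜.baseChange T.hom).sectionBaseChange ℓ.left (𝒜.sectionBaseChange T.hom τ)).left ≫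
      pullback.fst (pullback.snd 𝒜.X.hom T.hom) ℓ.left = ℓ.left ≫ (𝒜.sectionBaseChange T.hom τ).left :=
    (𝒜.baseChange T.hom).sectionBaseChange_left_comp_fst ℓ.left (𝒜.sectionBaseChange T.hom τ)
  have h2 : (𝒜.sectionBaseChange T.hom τ).left ≫ pullback.fst 𝒜.X.hom T.hom = T.hom ≫ τ.left :=
    𝒜.sectionBaseChange_left_comp_fst T.hom τ
  have h3 : (𝒜.sectionBaseChange G.hom τ).left ≫ pullback.fst 𝒜.X.hom G.hom = G.hom ≫ τ.left :=
    𝒜.sectionBaseChange_left_comp_fst G.hom τ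
  apply pullback.hom_ext
  · rw [Category.assoc, pullbackFacObjIso_hom_left_fst]
    erw [reassoc_of% h1]
    rw [h2, h3, ← Category.assoc, Over.w ℓ]
  · rw [Category.assoc, pullbackFacObjIso_hom_left_snd]
    exact (Over.w ((𝒜.baseChange T.hom).sectionBaseChange ℓ.left (𝒜.sectionBaseChange T.hom τ))).trans
      (Over.w (𝒜.sectionBaseChange G.hom τ)).symm

/-- The same read the other way: `τ ×_X G`, moved to `(𝒜 ×_X T) ×_T G`, is `(τ ×_X T) ×_T G`. [cite: MumfordFogartyKirwan1994, Ch. 7 §2 Definition 7.2 (p. 129)]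
[cite: GortzWedhorn2020, Prop. 4.16 (p. 101)] -/
theorem sectionBaseChange_comp_facObjIso_inv (τ : 𝒜.Sections) :
    𝒜.sectionBaseChange G.hom τ ≫ (facObjIso ℓ 𝒜.X).inv =
      (𝒜.baseChange T.hom).sectionBaseChange ℓ.left (𝒜.sectionBaseChange T.hom τ) := by
  rw [← sectionBaseChange_sectionBaseChange_comp_facObjIso_hom ℓ 𝒜 τ, Category.assoc, Iso.hom_inv_id, Category.comp_id]

end Sections

/-! ### §2 `(facObjIso ℓ 𝒜.X, facObjIso ℓ Â.X)` is a five-clause relation along `𝟙 G`, `𝒪`-equivariantly, in both directions -/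

section TupleRel

variable {X : Scheme.{u}} {T G : Over X} (ℓ : G ⟶ T) (𝒜 : AbelianSchemeOver X) {ℬ : AbelianSchemeOver X}
  {O : Type*} [CommRing O] (ρ : RingAction O 𝒜) (D : 𝒜.DualPair) (pol : 𝒜.Polarization D) {g n : ℕ} (lvl : 𝒜.LevelStructure g n)

/-- **Naturality of `facObjIso` in the abelian scheme** (★ `pullbackFacObjIso_naturality`): for `φ : 𝒜 → ℬ` over `X`,
`(φ_T)_ℓ ≫ e_ℬ = e_𝒜 ≫ φ_G`. [cite: GortzWedhorn2020, Section (4.7) (pp. 107–108)] -/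
theorem facObjIso_hom_naturality (φ : 𝒜.X ⟶ ℬ.X) :
    (Over.pullback ℓ.left).map ((Over.pullback T.hom).map φ) ≫ (facObjIso ℓ ℬ.X).hom = (facObjIso ℓ 𝒜.X).hom ≫ (Over.pullback G.hom).map φ :=
  pullbackFacObjIso_naturality T.hom ℓ.left G.hom (Over.w ℓ) φ

/-- Naturality of the inverse: `φ_G ≫ e_ℬ⁻¹ = e_𝒜⁻¹ ≫ (φ_T)_ℓ`. [cite: GortzWedhorn2020, Section (4.7) (pp. 107–108)] -/
theorem facObjIso_inv_naturality (φ : 𝒜.X ⟶ ℬ.X) :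
    (Over.pullback G.hom).map φ ≫ (facObjIso ℓ ℬ.X).inv = (facObjIso ℓ 𝒜.X).inv ≫ (Over.pullback ℓ.left).map ((Over.pullback T.hom).map φ) := by
  rw [Iso.comp_inv_eq, Category.assoc, Iso.eq_inv_comp, facObjIso_hom_naturality]

/-- **`(facObjIso ℓ 𝒜.X, facObjIso ℓ Â.X) : ((tuple ×_X T) ×_T G) → (tuple ×_X G)` IS A FIVE-CLAUSE RELATION ALONG `𝟙 G`** for the pulled-back
tuples `(𝒜, ι, Â, 𝒫, λ, lvl)`: level ∕ `X` (§1 + ★ `levelStructure_isBaseChangeVia_id_of_isMonHom`, ★ `isMonHom_facObjIso_hom`), `X̂` (★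
`isBaseChangeVia_id_of_isMonHom`), Poincaré (both Poincaré sheaves are pull-backs of `𝒫` along maps agreeing after `facObjIso`: ★
`DualPair.nonempty_pullback_map_iso_of_comp_eq` with ★ `pullbackFacObjIso_hom_left_fst`), `λ` and `ι` (naturality).
[cite: MumfordFogartyKirwan1994, Ch. 7 §2 Definition 7.2 (p. 129)] [cite: GortzWedhorn2020, Section (4.7) (pp. 107–108) and Prop. 4.16 (p. 101)] -/
theorem tupleRel_facObjIso_hom :
    ((lvl.baseChange T.hom).baseChange ℓ.left).IsBaseChangeVia (lvl.baseChange G.hom) (𝟙 G.left) (facObjIso ℓ 𝒜.X).hom.left ∧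
      ((D.baseChange T.hom).baseChange ℓ.left).hat.IsBaseChangeVia (D.baseChange G.hom).hat (𝟙 G.left) (facObjIso ℓ D.hat.X).hom.left ∧
      (∃ (wG : ((𝒜.baseChange T.hom).baseChange ℓ.left).X.hom ≫ 𝟙 G.left = (facObjIso ℓ 𝒜.X).hom.left ≫ (𝒜.baseChange G.hom).X.hom)
          (wĜ : ((D.baseChange T.hom).baseChange ℓ.left).hat.X.hom ≫ 𝟙 G.left =
            (facObjIso ℓ D.hat.X).hom.left ≫ (D.baseChange G.hom).hat.X.hom),
        Nonempty ((Scheme.Modules.pullback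
          (pullback.map ((𝒜.baseChange T.hom).baseChange ℓ.left).X.hom ((D.baseChange T.hom).baseChange ℓ.left).hat.X.hom
            (𝒜.baseChange G.hom).X.hom (D.baseChange G.hom).hat.X.hom (facObjIso ℓ 𝒜.X).hom.left (facObjIso ℓ D.hat.X).hom.left
            (𝟙 G.left) wG wĜ)).obj (D.baseChange G.hom).P ≅ ((D.baseChange T.hom).baseChange ℓ.left).P)) ∧
      ((pol.baseChange T.hom).baseChange ℓ.left).lam.left ≫ (facObjIso ℓ D.hat.X).hom.left =
        (facObjIso ℓ 𝒜.X).hom.left ≫ (pol.baseChange G.hom).lam.left ∧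
      ∀ a : O, (baseChangeHom (baseChangeHom (ρ.i a) T.hom) ℓ.left).left ≫ (facObjIso ℓ 𝒜.X).hom.left =
        (facObjIso ℓ 𝒜.X).hom.left ≫ (baseChangeHom (ρ.i a) G.hom).left := by
  -- `facObjIso` is a homomorphism for the induced laws (★), read on the `baseChange` spellings of its source and target
  haveI : IsMonHom (M := ((𝒜.baseChange T.hom).baseChange ℓ.left).X) (N := (𝒜.baseChange G.hom).X) (facObjIso ℓ 𝒜.X).hom :=
    isMonHom_facObjIso_hom ℓ 𝒜.X
  haveI : IsMonHom (M := ((D.hat.baseChange T.hom).baseChange ℓ.left).X) (N := (D.hat.baseChange G.hom).X)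
      (facObjIso ℓ D.hat.X).hom :=
    isMonHom_facObjIso_hom ℓ D.hat.X
  have wH : ((𝒜.baseChange T.hom).baseChange ℓ.left).X.hom ≫ 𝟙 G.left = (facObjIso ℓ 𝒜.X).hom.left ≫ (𝒜.baseChange G.hom).X.hom := by
    rw [Category.comp_id]
    exact (Over.w (facObjIso ℓ 𝒜.X).hom).symm
  have wĤ : ((D.baseChange T.hom).baseChange ℓ.left).hat.X.hom ≫ 𝟙 G.left =
      (facObjIso ℓ D.hat.X).hom.left ≫ (D.baseChange G.hom).hat.X.hom := by
    rw [Category.comp_id]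
    exact (Over.w (facObjIso ℓ D.hat.X).hom).symm
  -- Poincaré: both sheaves are pull-backs of `𝒫` (★ canonical clauses), and the maps to `𝒜 ×_X Â` agree after `facObjIso`
  have wAb : (𝒜.baseChange G.hom).X.hom ≫ G.hom = pullback.fst 𝒜.X.hom G.hom ≫ 𝒜.X.hom := pullback.condition.symm
  have wHb : (D.baseChange G.hom).hat.X.hom ≫ G.hom = pullback.fst D.hat.X.hom G.hom ≫ D.hat.X.hom := pullback.condition.symm
  obtain ⟨eb⟩ := D.nonempty_pullback_map_P_iso_baseChange_P G.hom wAb wHb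
  -- the iterated Poincaré clause, RE-READ along `G.hom` (`ℓ ≫ T.hom = G.hom`; `pullback.map` does not depend on the base map)
  obtain ⟨e₂⟩ := DualPair.nonempty_pullback_map_P_iso_baseChange_baseChange_P 𝒜 D T.hom ℓ.left
  have e₂' : (Scheme.Modules.pullback (pullback.map ((𝒜.baseChange T.hom).baseChange ℓ.left).X.hom
      ((D.baseChange T.hom).baseChange ℓ.left).hat.X.hom 𝒜.X.hom D.hat.X.hom
      (pullback.fst (pullback.snd 𝒜.X.hom T.hom) ℓ.left ≫ pullback.fst 𝒜.X.hom T.hom)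
      (pullback.fst (pullback.snd D.hat.X.hom T.hom) ℓ.left ≫ pullback.fst D.hat.X.hom T.hom) G.hom
      (baseChange_baseChange_hom_comp_of_fac ℓ 𝒜) (baseChange_baseChange_hom_comp_of_fac ℓ D.hat))).obj D.P ≅
      ((D.baseChange T.hom).baseChange ℓ.left).P :=
    (Scheme.Modules.pullbackCongr (pullback_map_fst_fst_congr_base ℓ 𝒜 D)).app D.P ≪≫ e₂
  have hP := DualPair.nonempty_pullback_map_iso_of_comp_eq D (D.baseChange G.hom) ((D.baseChange T.hom).baseChange ℓ.left)
    wAb wHb (baseChange_baseChange_hom_comp_of_fac ℓ 𝒜) (baseChange_baseChange_hom_comp_of_fac ℓ D.hat) eb e₂'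
    (pullbackFacObjIso_hom_left_fst T.hom ℓ.left G.hom (Over.w ℓ) 𝒜.X)
    (pullbackFacObjIso_hom_left_fst T.hom ℓ.left G.hom (Over.w ℓ) D.hat.X) wH wĤ
  have h₁ : ((lvl.baseChange T.hom).baseChange ℓ.left).IsBaseChangeVia (lvl.baseChange G.hom) (𝟙 G.left) (facObjIso ℓ 𝒜.X).hom.left :=
    levelStructure_isBaseChangeVia_id_of_isMonHom ((lvl.baseChange T.hom).baseChange ℓ.left) (lvl.baseChange G.hom)
      (facObjIso ℓ 𝒜.X).hom (fun i => sectionBaseChange_sectionBaseChange_comp_facObjIso_hom ℓ 𝒜 (lvl.σ i))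
  have h₂ : ((D.baseChange T.hom).baseChange ℓ.left).hat.IsBaseChangeVia (D.baseChange G.hom).hat (𝟙 G.left)
      (facObjIso ℓ D.hat.X).hom.left :=
    isBaseChangeVia_id_of_isMonHom ((D.hat.baseChange T.hom).baseChange ℓ.left) (D.hat.baseChange G.hom) (facObjIso ℓ D.hat.X).hom
  have h₄ : ((pol.baseChange T.hom).baseChange ℓ.left).lam.left ≫ (facObjIso ℓ D.hat.X).hom.left =
      (facObjIso ℓ 𝒜.X).hom.left ≫ (pol.baseChange G.hom).lam.left := by
    rw [← Over.comp_left, ← Over.comp_left]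
    exact congrArg CommaMorphism.left (facObjIso_hom_naturality ℓ 𝒜 pol.lam)
  have h₅ : ∀ a : O, (baseChangeHom (baseChangeHom (ρ.i a) T.hom) ℓ.left).left ≫ (facObjIso ℓ 𝒜.X).hom.left =
      (facObjIso ℓ 𝒜.X).hom.left ≫ (baseChangeHom (ρ.i a) G.hom).left := fun a => by
    rw [← Over.comp_left, ← Over.comp_left]
    exact congrArg CommaMorphism.left (facObjIso_hom_naturality ℓ 𝒜 (ρ.i a))
  exact ⟨h₁, h₂, ⟨wH, wĤ, hP⟩, h₄, h₅⟩

/-- **The inverse identification `(facObjIso⁻¹, facObjIso⁻¹) : (tuple ×_X G) → ((tuple ×_X T) ×_T G)` IS A FIVE-CLAUSE RELATION ALONG `𝟙 G`**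
(§1 `sectionBaseChange_comp_facObjIso_inv`, ★ `isMonHom_facObjIso_inv`, ★ `OverFac.facObjIso_inv_left_fst_fst`, naturality of the inverse).
[cite: MumfordFogartyKirwan1994, Ch. 7 §2 Definition 7.2 (p. 129)] [cite: GortzWedhorn2020, Section (4.7) (pp. 107–108) and Prop. 4.16 (p. 101)] -/
theorem tupleRel_facObjIso_inv :
    (lvl.baseChange G.hom).IsBaseChangeVia ((lvl.baseChange T.hom).baseChange ℓ.left) (𝟙 G.left) (facObjIso ℓ 𝒜.X).inv.left ∧
      (D.baseChange G.hom).hat.IsBaseChangeVia ((D.baseChange T.hom).baseChange ℓ.left).hat (𝟙 G.left) (facObjIso ℓ D.hat.X).inv.left ∧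
      (∃ (wG : (𝒜.baseChange G.hom).X.hom ≫ 𝟙 G.left = (facObjIso ℓ 𝒜.X).inv.left ≫ ((𝒜.baseChange T.hom).baseChange ℓ.left).X.hom)
          (wĜ : (D.baseChange G.hom).hat.X.hom ≫ 𝟙 G.left =
            (facObjIso ℓ D.hat.X).inv.left ≫ ((D.baseChange T.hom).baseChange ℓ.left).hat.X.hom),
        Nonempty ((Scheme.Modules.pullback
          (pullback.map (𝒜.baseChange G.hom).X.hom (D.baseChange G.hom).hat.X.hom ((𝒜.baseChange T.hom).baseChange ℓ.left).X.hom
            ((D.baseChange T.hom).baseChange ℓ.left).hat.X.hom (facObjIso ℓ 𝒜.X).inv.left (facObjIso ℓ D.hat.X).inv.left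
            (𝟙 G.left) wG wĜ)).obj ((D.baseChange T.hom).baseChange ℓ.left).P ≅ (D.baseChange G.hom).P)) ∧
      (pol.baseChange G.hom).lam.left ≫ (facObjIso ℓ D.hat.X).inv.left =
        (facObjIso ℓ 𝒜.X).inv.left ≫ ((pol.baseChange T.hom).baseChange ℓ.left).lam.left ∧
      ∀ a : O, (baseChangeHom (ρ.i a) G.hom).left ≫ (facObjIso ℓ 𝒜.X).inv.left =
        (facObjIso ℓ 𝒜.X).inv.left ≫ (baseChangeHom (baseChangeHom (ρ.i a) T.hom) ℓ.left).left := by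
  haveI : IsMonHom (M := (𝒜.baseChange G.hom).X) (N := ((𝒜.baseChange T.hom).baseChange ℓ.left).X) (facObjIso ℓ 𝒜.X).inv :=
    isMonHom_facObjIso_inv ℓ 𝒜.X
  haveI : IsMonHom (M := (D.hat.baseChange G.hom).X) (N := ((D.hat.baseChange T.hom).baseChange ℓ.left).X)
      (facObjIso ℓ D.hat.X).inv :=
    isMonHom_facObjIso_inv ℓ D.hat.X
  have wH : (𝒜.baseChange G.hom).X.hom ≫ 𝟙 G.left = (facObjIso ℓ 𝒜.X).inv.left ≫ ((𝒜.baseChange T.hom).baseChange ℓ.left).X.hom := by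
    rw [Category.comp_id]
    exact (Over.w (facObjIso ℓ 𝒜.X).inv).symm
  have wĤ : (D.baseChange G.hom).hat.X.hom ≫ 𝟙 G.left =
      (facObjIso ℓ D.hat.X).inv.left ≫ ((D.baseChange T.hom).baseChange ℓ.left).hat.X.hom := by
    rw [Category.comp_id]
    exact (Over.w (facObjIso ℓ D.hat.X).inv).symm
  have wAb : (𝒜.baseChange G.hom).X.hom ≫ G.hom = pullback.fst 𝒜.X.hom G.hom ≫ 𝒜.X.hom := pullback.condition.symm
  have wHb : (D.baseChange G.hom).hat.X.hom ≫ G.hom = pullback.fst D.hat.X.hom G.hom ≫ D.hat.X.hom := pullback.condition.symm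
  obtain ⟨eb⟩ := D.nonempty_pullback_map_P_iso_baseChange_P G.hom wAb wHb
  obtain ⟨e₂⟩ := DualPair.nonempty_pullback_map_P_iso_baseChange_baseChange_P 𝒜 D T.hom ℓ.left
  have e₂' : (Scheme.Modules.pullback (pullback.map ((𝒜.baseChange T.hom).baseChange ℓ.left).X.hom
      ((D.baseChange T.hom).baseChange ℓ.left).hat.X.hom 𝒜.X.hom D.hat.X.hom
      (pullback.fst (pullback.snd 𝒜.X.hom T.hom) ℓ.left ≫ pullback.fst 𝒜.X.hom T.hom)
      (pullback.fst (pullback.snd D.hat.X.hom T.hom) ℓ.left ≫ pullback.fst D.hat.X.hom T.hom) G.hom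
      (baseChange_baseChange_hom_comp_of_fac ℓ 𝒜) (baseChange_baseChange_hom_comp_of_fac ℓ D.hat))).obj D.P ≅
      ((D.baseChange T.hom).baseChange ℓ.left).P :=
    (Scheme.Modules.pullbackCongr (pullback_map_fst_fst_congr_base ℓ 𝒜 D)).app D.P ≪≫ e₂
  have hP := DualPair.nonempty_pullback_map_iso_of_comp_eq D ((D.baseChange T.hom).baseChange ℓ.left) (D.baseChange G.hom)
    (baseChange_baseChange_hom_comp_of_fac ℓ 𝒜) (baseChange_baseChange_hom_comp_of_fac ℓ D.hat) wAb wHb e₂' eb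
    (facObjIso_inv_left_fst_fst ℓ 𝒜.X) (facObjIso_inv_left_fst_fst ℓ D.hat.X) wH wĤ
  have h₁ : (lvl.baseChange G.hom).IsBaseChangeVia ((lvl.baseChange T.hom).baseChange ℓ.left) (𝟙 G.left) (facObjIso ℓ 𝒜.X).inv.left :=
    levelStructure_isBaseChangeVia_id_of_isMonHom (lvl.baseChange G.hom) ((lvl.baseChange T.hom).baseChange ℓ.left)
      (facObjIso ℓ 𝒜.X).inv (fun i => sectionBaseChange_comp_facObjIso_inv ℓ 𝒜 (lvl.σ i))
  have h₂ : (D.baseChange G.hom).hat.IsBaseChangeVia ((D.baseChange T.hom).baseChange ℓ.left).hat (𝟙 G.left)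
      (facObjIso ℓ D.hat.X).inv.left :=
    isBaseChangeVia_id_of_isMonHom (D.hat.baseChange G.hom) ((D.hat.baseChange T.hom).baseChange ℓ.left) (facObjIso ℓ D.hat.X).inv
  have h₄ : (pol.baseChange G.hom).lam.left ≫ (facObjIso ℓ D.hat.X).inv.left =
      (facObjIso ℓ 𝒜.X).inv.left ≫ ((pol.baseChange T.hom).baseChange ℓ.left).lam.left := by
    rw [← Over.comp_left, ← Over.comp_left]
    exact congrArg CommaMorphism.left (facObjIso_inv_naturality ℓ 𝒜 pol.lam)
  have h₅ : ∀ a : O, (baseChangeHom (ρ.i a) G.hom).left ≫ (facObjIso ℓ 𝒜.X).inv.left =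
      (facObjIso ℓ 𝒜.X).inv.left ≫ (baseChangeHom (baseChangeHom (ρ.i a) T.hom) ℓ.left).left := fun a => by
    rw [← Over.comp_left, ← Over.comp_left]
    exact congrArg CommaMorphism.left (facObjIso_inv_naturality ℓ 𝒜 (ρ.i a))
  exact ⟨h₁, h₂, ⟨wH, wĤ, hP⟩, h₄, h₅⟩

end TupleRel

/-! ### §3 The two factorisations of the SPREAD door: a finer stage, and an `A`-algebra `T` with `t ∈ Tˣ`, versus the generic base -/

section Stage

open Literature.AlgebraicGeometry.Motives (SchemeOver specOver)
open Literature.AlgebraicGeometry.Limits.LocApprox (Idx baseDiagram leg genOver stageOver relLeg overOf)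

variable {A : Type u} [CommRing A] (S : Submonoid A) (K : Type u) [CommRing K] [Algebra A K] [IsLocalization S K]
  (P : SchemeOver A) {s t : Idx S} (σ : s ⟶ t) (T : Type u) [CommRing T] [Algebra A T]
  (𝒜 : AbelianSchemeOver (P ⊗ (baseDiagram S).obj t).left) {O : Type*} [CommRing O] (ρ : RingAction O 𝒜) (D : 𝒜.DualPair)
  (pol : 𝒜.Polarization D) {g n : ℕ} (lvl : 𝒜.LevelStructure g n)
  (τ : specOver A T ⟶ (baseDiagram S).obj t) (κ : specOver A K ⟶ specOver A T)

/-- **(a) FINER STAGE VERSUS GENERIC BASE** — the junction with ★ (s1-ι) `exists_stage_ringAction`, ★ `exists_stage_monHom`, ★ (s3), ★ (s2-λ″):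
for `σ : s ⟶ t`, `(facObjIso (relLeg σ) 𝒜.X, facObjIso (relLeg σ) Â.X) : ((tuple|ₛ) ×_{P⊗D(s)} (P ⊗ Spec K)) → (tuple ×_{P⊗D(t)} (P ⊗ Spec K))`
is a five-clause relation along `𝟙`, `𝒪`-equivariantly (`tuple|ₛ = tuple ×_{P⊗D(t)} (P ⊗ D(s))`, ★ `stageOver`; generic base ★ `genOver`; ★
`relLeg`).  So an organ output «`(zₛ)_K ≫ facObjIso.hom = facObjIso.hom ≫ z`» is the `λ`-∕`ι`-clause of a six-clause relation between the
generic tuples. [cite: EGAIV3, Thm. 8.8.2 (i)] [cite: MumfordFogartyKirwan1994, Ch. 7 §2 Definition 7.2 (p. 129)] [cite: GortzWedhorn2020, §(10.13) and Prop. 4.16] -/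
theorem tupleRel_facObjIso_relLeg_hom :
    ((lvl.baseChange (stageOver S P σ).hom).baseChange (relLeg S K P σ).left).IsBaseChangeVia (lvl.baseChange (genOver S K P t).hom)
        (𝟙 (genOver S K P t).left) (facObjIso (relLeg S K P σ) 𝒜.X).hom.left ∧
      ((D.baseChange (stageOver S P σ).hom).baseChange (relLeg S K P σ).left).hat.IsBaseChangeVia (D.baseChange (genOver S K P t).hom).hat
        (𝟙 (genOver S K P t).left) (facObjIso (relLeg S K P σ) D.hat.X).hom.left ∧
      (∃ (wG : ((𝒜.baseChange (stageOver S P σ).hom).baseChange (relLeg S K P σ).left).X.hom ≫ 𝟙 (genOver S K P t).left =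
            (facObjIso (relLeg S K P σ) 𝒜.X).hom.left ≫ (𝒜.baseChange (genOver S K P t).hom).X.hom)
          (wĜ : ((D.baseChange (stageOver S P σ).hom).baseChange (relLeg S K P σ).left).hat.X.hom ≫ 𝟙 (genOver S K P t).left =
            (facObjIso (relLeg S K P σ) D.hat.X).hom.left ≫ (D.baseChange (genOver S K P t).hom).hat.X.hom),
        Nonempty ((Scheme.Modules.pullback
          (pullback.map ((𝒜.baseChange (stageOver S P σ).hom).baseChange (relLeg S K P σ).left).X.hom
            ((D.baseChange (stageOver S P σ).hom).baseChange (relLeg S K P σ).left).hat.X.hom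
            (𝒜.baseChange (genOver S K P t).hom).X.hom (D.baseChange (genOver S K P t).hom).hat.X.hom
            (facObjIso (relLeg S K P σ) 𝒜.X).hom.left (facObjIso (relLeg S K P σ) D.hat.X).hom.left
            (𝟙 (genOver S K P t).left) wG wĜ)).obj (D.baseChange (genOver S K P t).hom).P ≅
          ((D.baseChange (stageOver S P σ).hom).baseChange (relLeg S K P σ).left).P)) ∧
      ((pol.baseChange (stageOver S P σ).hom).baseChange (relLeg S K P σ).left).lam.left ≫ (facObjIso (relLeg S K P σ) D.hat.X).hom.left =
        (facObjIso (relLeg S K P σ) 𝒜.X).hom.left ≫ (pol.baseChange (genOver S K P t).hom).lam.left ∧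
      ∀ a : O, (baseChangeHom (baseChangeHom (ρ.i a) (stageOver S P σ).hom) (relLeg S K P σ).left).left ≫
          (facObjIso (relLeg S K P σ) 𝒜.X).hom.left =
        (facObjIso (relLeg S K P σ) 𝒜.X).hom.left ≫ (baseChangeHom (ρ.i a) (genOver S K P t).hom).left :=
  tupleRel_facObjIso_hom (relLeg S K P σ) 𝒜 ρ D pol lvl

/-- (a′) The inverse direction `(tuple ×_{P⊗D(t)} (P ⊗ Spec K)) → ((tuple|ₛ) ×_{P⊗D(s)} (P ⊗ Spec K))`. [cite: MumfordFogartyKirwan1994, Ch. 7 §2 Definition 7.2 (p. 129)]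
[cite: GortzWedhorn2020, §(10.13) and Prop. 4.16] -/
theorem tupleRel_facObjIso_relLeg_inv :
    (lvl.baseChange (genOver S K P t).hom).IsBaseChangeVia ((lvl.baseChange (stageOver S P σ).hom).baseChange (relLeg S K P σ).left)
        (𝟙 (genOver S K P t).left) (facObjIso (relLeg S K P σ) 𝒜.X).inv.left ∧
      (D.baseChange (genOver S K P t).hom).hat.IsBaseChangeVia ((D.baseChange (stageOver S P σ).hom).baseChange (relLeg S K P σ).left).hat
        (𝟙 (genOver S K P t).left) (facObjIso (relLeg S K P σ) D.hat.X).inv.left ∧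
      (∃ (wG : (𝒜.baseChange (genOver S K P t).hom).X.hom ≫ 𝟙 (genOver S K P t).left =
            (facObjIso (relLeg S K P σ) 𝒜.X).inv.left ≫ ((𝒜.baseChange (stageOver S P σ).hom).baseChange (relLeg S K P σ).left).X.hom)
          (wĜ : (D.baseChange (genOver S K P t).hom).hat.X.hom ≫ 𝟙 (genOver S K P t).left =
            (facObjIso (relLeg S K P σ) D.hat.X).inv.left ≫ ((D.baseChange (stageOver S P σ).hom).baseChange (relLeg S K P σ).left).hat.X.hom),
        Nonempty ((Scheme.Modules.pullback
          (pullback.map (𝒜.baseChange (genOver S K P t).hom).X.hom (D.baseChange (genOver S K P t).hom).hat.X.hom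
            ((𝒜.baseChange (stageOver S P σ).hom).baseChange (relLeg S K P σ).left).X.hom
            ((D.baseChange (stageOver S P σ).hom).baseChange (relLeg S K P σ).left).hat.X.hom
            (facObjIso (relLeg S K P σ) 𝒜.X).inv.left (facObjIso (relLeg S K P σ) D.hat.X).inv.left
            (𝟙 (genOver S K P t).left) wG wĜ)).obj ((D.baseChange (stageOver S P σ).hom).baseChange (relLeg S K P σ).left).P ≅
          (D.baseChange (genOver S K P t).hom).P)) ∧
      (pol.baseChange (genOver S K P t).hom).lam.left ≫ (facObjIso (relLeg S K P σ) D.hat.X).inv.left =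
        (facObjIso (relLeg S K P σ) 𝒜.X).inv.left ≫ ((pol.baseChange (stageOver S P σ).hom).baseChange (relLeg S K P σ).left).lam.left ∧
      ∀ a : O, (baseChangeHom (ρ.i a) (genOver S K P t).hom).left ≫ (facObjIso (relLeg S K P σ) 𝒜.X).inv.left =
        (facObjIso (relLeg S K P σ) 𝒜.X).inv.left ≫
          (baseChangeHom (baseChangeHom (ρ.i a) (stageOver S P σ).hom) (relLeg S K P σ).left).left :=
  tupleRel_facObjIso_inv (relLeg S K P σ) 𝒜 ρ D pol lvl

/-- **(b) THE `T`-LEG VERSUS THE GENERIC BASE — the NAMED-MAP edition of ★ `exists_tupleRel_stage_baseChange_specOver`.**  For `τ : Spec T → D(t)`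
over `Spec A` (it exists iff `t ∈ Tˣ`, ★ `nonempty_hom_specOver_baseDiagram_of_isUnit`) and ANY morphism `ℓ_T : P ⊗ Spec K ⟶ P ⊗ Spec T` over
`P ⊗ D(t)` (★ `genOver` ⟶ ★ `overOf τ`; the canonical one is `Over.homMk (P ◁ κ).left (whiskerLeft_left_comp_whiskerLeft_left_eq_leg S K P t T τ κ)`
for an `A`-morphism `κ : Spec K → Spec T`), `(facObjIso ℓ_T 𝒜.X, facObjIso ℓ_T Â.X) : ((𝒜 ×_{P⊗D(t)} (P ⊗ Spec T)) ×_{P ⊗ Spec T} (P ⊗ Spec K)) →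
𝒜 ×_{P⊗D(t)} (P ⊗ Spec K)` is a five-clause relation along `𝟙`, `𝒪`-equivariantly — the `T`-tuple of ★ GS-2-core (base change along
`(overOf S P τ).hom = (P ◁ τ).left`) read generically through a NAMED isomorphism (the inverse direction is `tupleRel_facObjIso_inv ℓT 𝒜 ρ D pol lvl`, verbatim).
[cite: EGAIV3, Thm. 8.8.2 and 8.8.2.5] [cite: MumfordFogartyKirwan1994, Ch. 7 §2 Definition 7.2 (p. 129)] [cite: GortzWedhorn2020, Prop. 4.16 (p. 101) and Cor. 10.64 (2) (p. 329)] -/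
theorem tupleRel_facObjIso_specOver_hom (ℓT : genOver S K P t ⟶ overOf S P τ) :
    ((lvl.baseChange (overOf S P τ).hom).baseChange ℓT.left).IsBaseChangeVia (lvl.baseChange (genOver S K P t).hom)
        (𝟙 (genOver S K P t).left) (facObjIso ℓT 𝒜.X).hom.left ∧
      ((D.baseChange (overOf S P τ).hom).baseChange ℓT.left).hat.IsBaseChangeVia (D.baseChange (genOver S K P t).hom).hat
        (𝟙 (genOver S K P t).left) (facObjIso ℓT D.hat.X).hom.left ∧
      (∃ (wG : ((𝒜.baseChange (overOf S P τ).hom).baseChange ℓT.left).X.hom ≫ 𝟙 (genOver S K P t).left =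
            (facObjIso ℓT 𝒜.X).hom.left ≫ (𝒜.baseChange (genOver S K P t).hom).X.hom)
          (wĜ : ((D.baseChange (overOf S P τ).hom).baseChange ℓT.left).hat.X.hom ≫ 𝟙 (genOver S K P t).left =
            (facObjIso ℓT D.hat.X).hom.left ≫ (D.baseChange (genOver S K P t).hom).hat.X.hom),
        Nonempty ((Scheme.Modules.pullback
          (pullback.map ((𝒜.baseChange (overOf S P τ).hom).baseChange ℓT.left).X.hom
            ((D.baseChange (overOf S P τ).hom).baseChange ℓT.left).hat.X.hom
            (𝒜.baseChange (genOver S K P t).hom).X.hom (D.baseChange (genOver S K P t).hom).hat.X.hom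
            (facObjIso ℓT 𝒜.X).hom.left (facObjIso ℓT D.hat.X).hom.left (𝟙 (genOver S K P t).left) wG wĜ)).obj
              (D.baseChange (genOver S K P t).hom).P ≅
          ((D.baseChange (overOf S P τ).hom).baseChange ℓT.left).P)) ∧
      ((pol.baseChange (overOf S P τ).hom).baseChange ℓT.left).lam.left ≫ (facObjIso ℓT D.hat.X).hom.left =
        (facObjIso ℓT 𝒜.X).hom.left ≫ (pol.baseChange (genOver S K P t).hom).lam.left ∧
      ∀ a : O, (baseChangeHom (baseChangeHom (ρ.i a) (overOf S P τ).hom) ℓT.left).left ≫ (facObjIso ℓT 𝒜.X).hom.left =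
        (facObjIso ℓT 𝒜.X).hom.left ≫ (baseChangeHom (ρ.i a) (genOver S K P t).hom).left :=
  tupleRel_facObjIso_hom ℓT 𝒜 ρ D pol lvl

/-- **The canonical `T`-leg exists**: `Over.homMk (P ◁ κ).left _ : P ⊗ Spec K ⟶ P ⊗ Spec T` over `P ⊗ D(t)` for any `A`-morphism
`κ : Spec K → Spec T` (★ `whiskerLeft_left_comp_whiskerLeft_left_eq_leg`); recorded as an inhabitation with its underlying map pinned.
[cite: GortzWedhorn2020, Cor. 10.64 (2) (p. 329)] -/
theorem exists_hom_genOver_overOf_left_eq :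
    ∃ ℓT : genOver S K P t ⟶ overOf S P τ, ℓT.left = (P ◁ κ).left :=
  ⟨Over.homMk (P ◁ κ).left (whiskerLeft_left_comp_whiskerLeft_left_eq_leg S K P t T τ κ), rfl⟩

end Stage

end AbelianSchemeOver

end Literature.AlgebraicGeometry.AbelianSchemes

end
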